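import Literature.NumberTheory.Sieve.BombieriFriedlanderIwaniecTheorem7StarProofs
import HarnessLib

/-!
# Bombieri–Friedlander–Iwaniec 1986, Theorem 7* (§14): the sums `Δ*` over blocks of the five variables

Topic `Literature/NumberTheory/Sieve`, continuation of
`Literature.NumberTheory.Sieve.BombieriFriedlanderIwaniecTheorem7StarProofs`.  Everything here is
PROVED; no named fact is introduced.

The sums `Δ*(M, N, L, Q, R)` of BFI §14 (p. 244; `Literature.NumberTheory.Sieve.BFI.deltaStar`) have
the five variables in INITIAL ranges `l ≤ L`, `m ≤ M`, `n ≤ N`, `q ≤ Q`, `r ≤ R`, whereas the proof of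
Theorem 7 (p. 244: "By elementary arguments (familiar from the previous sections) the problem reduces
to estimating sums of the type `Δ₀`" with `r ∼ R`, `l ∼ L` and smooth dyadic weights) and the
`q ↔ s` symmetry of §13 (p. 241: "`mn = a + qrs` with `m ∼ M`, `n ∼ N`, `Q < q ≤ Q₁`, `r ∼ R`") work
block by block.  This file provides the calculus of blocks: the sum with the five ranges replaced by
arbitrary finite sets of positive integers (`BFI.deltaStarSets`), its identification with `Δ*`
(`BFI.deltaStar_eq_deltaStarSets`), exact splitting in the outer variables `r`, `l`, sub-additive
splitting in `q`, `m`, `n` (disjoint unions and set differences), and monotonicity in `r`, `l`.  In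
particular a dyadic block is bounded by at most eight sums `Δ*` with initial ranges at comparable
parameters (`BFI.deltaStarSets_Ioc_le`).  It also provides the bound used to DISCARD blocks of small
product `LMN` (both in the dyadic reduction `Δ → Δ₀` and before the `q ↔ s` switch):
`BFI.deltaStar_uniform_trivial` —
`Δ*(M,N,L,Q,R) ≤ C (X + |a| + 2) log³²(X + |a| + 2) + τ(|a|)² ⌊Q⌋⌊R⌋ + X (1 + log⌊Q⌋)²(1 + log⌊R⌋)²`,
`X = ⌊L⌋⌊M⌋⌊N⌋`, uniformly in all ranges and in `z` (divisor counting: `#{(q,r) : qr ∣ lmn − a} ≤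
τ(|lmn − a|)²`, multiplicity of `k = lmn` at most `τ(k)²`, fourth moment of `τ`; `φ(qr) ≥ φ(q)φ(r)`).

## References

* E. Bombieri, J. B. Friedlander, H. Iwaniec, *Primes in arithmetic progressions to large moduli*,
  Acta Math. 156 (1986), 203–251: §13 p. 241; §14 p. 244. [BombieriFriedlanderIwaniecActa1986]
-/

open Finset Real
open scoped ArithmeticFunction.sigma

namespace Literature.NumberTheory.Sieve

namespace BFI

/-! ### `Δ*` over arbitrary finite ranges -/

/-- The congruence count of §14 over finite sets `SM`, `SN` of values of `m`, `n` (rough weights):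
`∑_{m ∈ SM} ∑_{n ∈ SN} 1_rough(m) 1_rough(n) 1_{lmn ≡ a (d)}`. [cite: BombieriFriedlanderIwaniecActa1986, §14 p. 244] -/
noncomputable def setCongrCount (a : ℤ) (z : ℝ) (SM SN : Finset ℕ) (l d : ℕ) : ℝ :=
  ∑ m ∈ SM, ∑ n ∈ SN,
    if ((l * m * n : ℕ) : ZMod d) = (a : ZMod d) then roughIndicator z m * roughIndicator z n else 0

/-- The coprimality count of §14 over finite sets `SM`, `SN`:
`∑_{m ∈ SM} ∑_{n ∈ SN} 1_rough(m) 1_rough(n) 1_{(mn, d) = 1}`. [cite: BombieriFriedlanderIwaniecActa1986, §14 p. 244] -/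
noncomputable def setCoprimeCount (z : ℝ) (SM SN : Finset ℕ) (d : ℕ) : ℝ :=
  ∑ m ∈ SM, ∑ n ∈ SN, if (m * n).Coprime d then roughIndicator z m * roughIndicator z n else 0

/-- The `q`-sum of the brackets over a finite set `SQ` of moduli factors, at `(r, l)`. [folklore] -/
noncomputable def setQSum (a : ℤ) (z : ℝ) (SM SN SQ : Finset ℕ) (r l : ℕ) : ℝ :=
  ∑ q ∈ SQ.filter (fun q : ℕ => IsCoprime (q : ℤ) (a * l)),
    (setCongrCount a z SM SN l (q * r) - setCoprimeCount z SM SN (q * r) / (Nat.totient (q * r) : ℝ))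

/-- **`Δ*` over blocks**: the sum of BFI §14 with the five ranges replaced by finite sets,
`∑_{r ∈ SR, (r,a)=1} ∑_{l ∈ SL, (l,r)=1} 1_rough(l) |∑_{q ∈ SQ, (q,al)=1} (count − expected)|`.
[cite: BombieriFriedlanderIwaniecActa1986, §14 p. 244] -/
noncomputable def deltaStarSets (a : ℤ) (z : ℝ) (SM SN SL SQ SR : Finset ℕ) : ℝ :=
  ∑ r ∈ SR.filter (fun r : ℕ => IsCoprime (r : ℤ) a),
    ∑ l ∈ SL.filter (fun l : ℕ => l.Coprime r), roughIndicator z l * |setQSum a z SM SN SQ r l|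

/-- `Δ*(M, N, L, Q, R)` is `deltaStarSets` on the initial ranges. [folklore] -/
theorem deltaStar_eq_deltaStarSets (a : ℤ) (z M N L Q R : ℝ) :
    deltaStar a z M N L Q R =
      deltaStarSets a z (Icc 1 ⌊M⌋₊) (Icc 1 ⌊N⌋₊) (Icc 1 ⌊L⌋₊) (Icc 1 ⌊Q⌋₊) (Icc 1 ⌊R⌋₊) := by
  rfl

/-- `deltaStarSets ≥ 0`. [folklore] -/
theorem deltaStarSets_nonneg (a : ℤ) (z : ℝ) (SM SN SL SQ SR : Finset ℕ) :
    0 ≤ deltaStarSets a z SM SN SL SQ SR :=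
  Finset.sum_nonneg fun _ _ => Finset.sum_nonneg fun l _ =>
    mul_nonneg (roughIndicator_nonneg z l) (abs_nonneg _)

/-! ### The outer variables `r` and `l`: exact splitting and monotonicity -/

/-- Splitting the range of `r` over a disjoint union. [folklore] -/
theorem deltaStarSets_union_R (a : ℤ) (z : ℝ) (SM SN SL SQ : Finset ℕ) {A B : Finset ℕ}
    (h : Disjoint A B) :
    deltaStarSets a z SM SN SL SQ (A ∪ B) = deltaStarSets a z SM SN SL SQ A + deltaStarSets a z SM SN SL SQ B := by
  unfold deltaStarSets
  rw [Finset.filter_union, Finset.sum_union (Finset.disjoint_filter_filter h)]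

/-- Splitting the range of `l` over a disjoint union. [folklore] -/
theorem deltaStarSets_union_L (a : ℤ) (z : ℝ) (SM SN SQ SR : Finset ℕ) {A B : Finset ℕ}
    (h : Disjoint A B) :
    deltaStarSets a z SM SN (A ∪ B) SQ SR = deltaStarSets a z SM SN A SQ SR + deltaStarSets a z SM SN B SQ SR := by
  unfold deltaStarSets
  rw [← Finset.sum_add_distrib]
  refine Finset.sum_congr rfl fun r _ => ?_
  rw [Finset.filter_union, Finset.sum_union (Finset.disjoint_filter_filter h)]

/-- Monotonicity in the ranges of `r` and `l`. [folklore] -/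
theorem deltaStarSets_mono (a : ℤ) (z : ℝ) (SM SN SQ : Finset ℕ) {SL SL' SR SR' : Finset ℕ}
    (hL : SL ⊆ SL') (hR : SR ⊆ SR') :
    deltaStarSets a z SM SN SL SQ SR ≤ deltaStarSets a z SM SN SL' SQ SR' := by
  unfold deltaStarSets
  refine (Finset.sum_le_sum_of_subset_of_nonneg (Finset.filter_subset_filter _ hR) fun r _ _ =>
    Finset.sum_nonneg fun l _ => mul_nonneg (roughIndicator_nonneg z l) (abs_nonneg _)).trans ?_
  exact Finset.sum_le_sum fun r _ => Finset.sum_le_sum_of_subset_of_nonneg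
    (Finset.filter_subset_filter _ hL) fun l _ _ => mul_nonneg (roughIndicator_nonneg z l) (abs_nonneg _)

/-! ### The inner variables `q`, `m`, `n`: sub-additive splitting -/

/-- A pointwise inequality `|setQSum₁| ≤ |setQSum₂| + |setQSum₃|` for all `(r, l)` gives the
corresponding inequality of the sums `deltaStarSets`. [folklore] -/
theorem deltaStarSets_le_add_of_abs_le (a : ℤ) (z : ℝ) {SM₁ SN₁ SQ₁ SM₂ SN₂ SQ₂ SM₃ SN₃ SQ₃ : Finset ℕ}
    (SL SR : Finset ℕ)
    (h : ∀ r l : ℕ, |setQSum a z SM₁ SN₁ SQ₁ r l| ≤ |setQSum a z SM₂ SN₂ SQ₂ r l| + |setQSum a z SM₃ SN₃ SQ₃ r l|) :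
    deltaStarSets a z SM₁ SN₁ SL SQ₁ SR ≤ deltaStarSets a z SM₂ SN₂ SL SQ₂ SR + deltaStarSets a z SM₃ SN₃ SL SQ₃ SR := by
  unfold deltaStarSets
  rw [← Finset.sum_add_distrib]
  refine Finset.sum_le_sum fun r _ => ?_
  rw [← Finset.sum_add_distrib]
  refine Finset.sum_le_sum fun l _ => ?_
  rw [← mul_add]
  exact mul_le_mul_of_nonneg_left (h r l) (roughIndicator_nonneg z l)

/-- Splitting the range of `q` over a disjoint union (triangle inequality). [folklore] -/
theorem deltaStarSets_union_Q_le (a : ℤ) (z : ℝ) (SM SN SL SR : Finset ℕ) {A B : Finset ℕ}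
    (h : Disjoint A B) :
    deltaStarSets a z SM SN SL (A ∪ B) SR ≤ deltaStarSets a z SM SN SL A SR + deltaStarSets a z SM SN SL B SR := by
  refine deltaStarSets_le_add_of_abs_le a z SL SR fun r l => ?_
  unfold setQSum
  rw [Finset.filter_union, Finset.sum_union (Finset.disjoint_filter_filter h)]
  exact abs_add_le _ _

/-- The congruence count is additive in the set of `m`. [folklore] -/
theorem setCongrCount_union_M (a : ℤ) (z : ℝ) {A B : Finset ℕ} (h : Disjoint A B) (SN : Finset ℕ) (l d : ℕ) :
    setCongrCount a z (A ∪ B) SN l d = setCongrCount a z A SN l d + setCongrCount a z B SN l d := by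
  unfold setCongrCount; rw [Finset.sum_union h]

/-- The coprimality count is additive in the set of `m`. [folklore] -/
theorem setCoprimeCount_union_M (z : ℝ) {A B : Finset ℕ} (h : Disjoint A B) (SN : Finset ℕ) (d : ℕ) :
    setCoprimeCount z (A ∪ B) SN d = setCoprimeCount z A SN d + setCoprimeCount z B SN d := by
  unfold setCoprimeCount; rw [Finset.sum_union h]

/-- The congruence count is additive in the set of `n`. [folklore] -/
theorem setCongrCount_union_N (a : ℤ) (z : ℝ) (SM : Finset ℕ) {A B : Finset ℕ} (h : Disjoint A B) (l d : ℕ) :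
    setCongrCount a z SM (A ∪ B) l d = setCongrCount a z SM A l d + setCongrCount a z SM B l d := by
  unfold setCongrCount
  rw [← Finset.sum_add_distrib]
  exact Finset.sum_congr rfl fun m _ => Finset.sum_union h

/-- The coprimality count is additive in the set of `n`. [folklore] -/
theorem setCoprimeCount_union_N (z : ℝ) (SM : Finset ℕ) {A B : Finset ℕ} (h : Disjoint A B) (d : ℕ) :
    setCoprimeCount z SM (A ∪ B) d = setCoprimeCount z SM A d + setCoprimeCount z SM B d := by
  unfold setCoprimeCount
  rw [← Finset.sum_add_distrib]
  exact Finset.sum_congr rfl fun m _ => Finset.sum_union h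

/-- The `q`-sum is additive in the set of `m`. [folklore] -/
theorem setQSum_union_M (a : ℤ) (z : ℝ) {A B : Finset ℕ} (h : Disjoint A B) (SN SQ : Finset ℕ) (r l : ℕ) :
    setQSum a z (A ∪ B) SN SQ r l = setQSum a z A SN SQ r l + setQSum a z B SN SQ r l := by
  unfold setQSum
  rw [← Finset.sum_add_distrib]
  refine Finset.sum_congr rfl fun q _ => ?_
  rw [setCongrCount_union_M a z h, setCoprimeCount_union_M z h]
  ring

/-- The `q`-sum is additive in the set of `n`. [folklore] -/
theorem setQSum_union_N (a : ℤ) (z : ℝ) (SM : Finset ℕ) {A B : Finset ℕ} (h : Disjoint A B) (SQ : Finset ℕ) (r l : ℕ) :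
    setQSum a z SM (A ∪ B) SQ r l = setQSum a z SM A SQ r l + setQSum a z SM B SQ r l := by
  unfold setQSum
  rw [← Finset.sum_add_distrib]
  refine Finset.sum_congr rfl fun q _ => ?_
  rw [setCongrCount_union_N a z SM h, setCoprimeCount_union_N z SM h]
  ring

/-- Splitting the range of `m` over a disjoint union (triangle inequality). [folklore] -/
theorem deltaStarSets_union_M_le (a : ℤ) (z : ℝ) {A B : Finset ℕ} (h : Disjoint A B) (SN SL SQ SR : Finset ℕ) :
    deltaStarSets a z (A ∪ B) SN SL SQ SR ≤ deltaStarSets a z A SN SL SQ SR + deltaStarSets a z B SN SL SQ SR := by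
  refine deltaStarSets_le_add_of_abs_le a z SL SR fun r l => ?_
  rw [setQSum_union_M a z h]
  exact abs_add_le _ _

/-- Splitting the range of `n` over a disjoint union (triangle inequality). [folklore] -/
theorem deltaStarSets_union_N_le (a : ℤ) (z : ℝ) (SM : Finset ℕ) {A B : Finset ℕ} (h : Disjoint A B) (SL SQ SR : Finset ℕ) :
    deltaStarSets a z SM (A ∪ B) SL SQ SR ≤ deltaStarSets a z SM A SL SQ SR + deltaStarSets a z SM B SL SQ SR := by
  refine deltaStarSets_le_add_of_abs_le a z SL SR fun r l => ?_
  rw [setQSum_union_N a z SM h]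
  exact abs_add_le _ _

/-- A sub-range of `m` as a difference (triangle inequality): for `A ⊆ B`,
`Δ_sets(B ∖ A) ≤ Δ_sets(B) + Δ_sets(A)`. [folklore] -/
theorem deltaStarSets_sdiff_M_le (a : ℤ) (z : ℝ) {A B : Finset ℕ} (h : A ⊆ B) (SN SL SQ SR : Finset ℕ) :
    deltaStarSets a z (B \ A) SN SL SQ SR ≤ deltaStarSets a z B SN SL SQ SR + deltaStarSets a z A SN SL SQ SR := by
  refine deltaStarSets_le_add_of_abs_le a z SL SR fun r l => ?_
  have hB : B = (B \ A) ∪ A := (Finset.sdiff_union_of_subset h).symm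
  have hd : Disjoint (B \ A) A := Finset.sdiff_disjoint
  have : setQSum a z (B \ A) SN SQ r l = setQSum a z B SN SQ r l - setQSum a z A SN SQ r l := by
    conv_rhs => rw [hB, setQSum_union_M a z hd]
    ring
  rw [this]
  exact abs_sub _ _

/-- A sub-range of `n` as a difference (triangle inequality). [folklore] -/
theorem deltaStarSets_sdiff_N_le (a : ℤ) (z : ℝ) (SM : Finset ℕ) {A B : Finset ℕ} (h : A ⊆ B) (SL SQ SR : Finset ℕ) :
    deltaStarSets a z SM (B \ A) SL SQ SR ≤ deltaStarSets a z SM B SL SQ SR + deltaStarSets a z SM A SL SQ SR := by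
  refine deltaStarSets_le_add_of_abs_le a z SL SR fun r l => ?_
  have hB : B = (B \ A) ∪ A := (Finset.sdiff_union_of_subset h).symm
  have hd : Disjoint (B \ A) A := Finset.sdiff_disjoint
  have : setQSum a z SM (B \ A) SQ r l = setQSum a z SM B SQ r l - setQSum a z SM A SQ r l := by
    conv_rhs => rw [hB, setQSum_union_N a z SM hd]
    ring
  rw [this]
  exact abs_sub _ _

/-- A sub-range of `q` as a difference (triangle inequality). [folklore] -/
theorem deltaStarSets_sdiff_Q_le (a : ℤ) (z : ℝ) (SM SN SL SR : Finset ℕ) {A B : Finset ℕ} (h : A ⊆ B) :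
    deltaStarSets a z SM SN SL (B \ A) SR ≤ deltaStarSets a z SM SN SL B SR + deltaStarSets a z SM SN SL A SR := by
  refine deltaStarSets_le_add_of_abs_le a z SL SR fun r l => ?_
  have hB : B = (B \ A) ∪ A := (Finset.sdiff_union_of_subset h).symm
  have hd : Disjoint (B \ A) A := Finset.sdiff_disjoint
  have : setQSum a z SM SN (B \ A) r l = setQSum a z SM SN B r l - setQSum a z SM SN A r l := by
    unfold setQSum
    conv_rhs => rw [hB, Finset.filter_union, Finset.sum_union (Finset.disjoint_filter_filter hd)]
    ring
  rw [this]
  exact abs_sub _ _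

/-! ### Blocks `(X₁, X₂]` in terms of initial ranges -/

/-- The integers of the real range `(X₁, X₂]` are `[1, ⌊X₂⌋] ∖ [1, ⌊X₁⌋]`. [folklore] -/
theorem Ioc_floor_eq_sdiff (X₁ X₂ : ℝ) : Ioc ⌊X₁⌋₊ ⌊X₂⌋₊ = Icc 1 ⌊X₂⌋₊ \ Icc 1 ⌊X₁⌋₊ := by
  ext m
  simp only [Finset.mem_Ioc, Finset.mem_sdiff, Finset.mem_Icc]
  omega

/-- `[1, ⌊X₁⌋] ⊆ [1, ⌊X₂⌋]` for `X₁ ≤ X₂`. [folklore] -/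
theorem Icc_floor_subset {X₁ X₂ : ℝ} (h : X₁ ≤ X₂) : Icc 1 ⌊X₁⌋₊ ⊆ Icc 1 ⌊X₂⌋₊ :=
  Finset.Icc_subset_Icc_right (Nat.floor_mono h)

/-- **A block is bounded by eight initial-range sums**: for `X₁ ≤ X₂` in each of `m, n, q` and any
`L₁, R₁`, the block `m ∈ (M₁, M₂]`, `n ∈ (N₁, N₂]`, `l ∈ (L₁, L₂]`, `q ∈ (Q₁, Q₂]`, `r ∈ (R₁, R₂]` satisfies
`Δ_block ≤ ∑_{i,j,k ∈ {1,2}} Δ*(M_i, N_j, L₂, Q_k, R₂)`. [cite: BombieriFriedlanderIwaniecActa1986, §14 p. 244] -/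
theorem deltaStarSets_Ioc_le (a : ℤ) (z : ℝ) {M₁ M₂ N₁ N₂ Q₁ Q₂ : ℝ} (hM : M₁ ≤ M₂) (hN : N₁ ≤ N₂)
    (hQ : Q₁ ≤ Q₂) (L₁ L₂ R₁ R₂ : ℝ) :
    deltaStarSets a z (Ioc ⌊M₁⌋₊ ⌊M₂⌋₊) (Ioc ⌊N₁⌋₊ ⌊N₂⌋₊) (Ioc ⌊L₁⌋₊ ⌊L₂⌋₊) (Ioc ⌊Q₁⌋₊ ⌊Q₂⌋₊)
        (Ioc ⌊R₁⌋₊ ⌊R₂⌋₊) ≤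
      deltaStar a z M₂ N₂ L₂ Q₂ R₂ + deltaStar a z M₂ N₂ L₂ Q₁ R₂ +
      (deltaStar a z M₂ N₁ L₂ Q₂ R₂ + deltaStar a z M₂ N₁ L₂ Q₁ R₂) +
      (deltaStar a z M₁ N₂ L₂ Q₂ R₂ + deltaStar a z M₁ N₂ L₂ Q₁ R₂ +
      (deltaStar a z M₁ N₁ L₂ Q₂ R₂ + deltaStar a z M₁ N₁ L₂ Q₁ R₂)) := by
  simp only [deltaStar_eq_deltaStarSets]
  -- notation for the initial ranges
  set IM₁ := Icc 1 ⌊M₁⌋₊; set IM₂ := Icc 1 ⌊M₂⌋₊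
  set IN₁ := Icc 1 ⌊N₁⌋₊; set IN₂ := Icc 1 ⌊N₂⌋₊
  set IQ₁ := Icc 1 ⌊Q₁⌋₊; set IQ₂ := Icc 1 ⌊Q₂⌋₊
  set IL₂ := Icc 1 ⌊L₂⌋₊; set IR₂ := Icc 1 ⌊R₂⌋₊
  -- enlarge `l`, `r`
  have h0 : deltaStarSets a z (Ioc ⌊M₁⌋₊ ⌊M₂⌋₊) (Ioc ⌊N₁⌋₊ ⌊N₂⌋₊) (Ioc ⌊L₁⌋₊ ⌊L₂⌋₊) (Ioc ⌊Q₁⌋₊ ⌊Q₂⌋₊)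
      (Ioc ⌊R₁⌋₊ ⌊R₂⌋₊) ≤
      deltaStarSets a z (IM₂ \ IM₁) (IN₂ \ IN₁) IL₂ (IQ₂ \ IQ₁) IR₂ := by
    simp only [Ioc_floor_eq_sdiff]
    exact deltaStarSets_mono a z _ _ _ Finset.sdiff_subset Finset.sdiff_subset
  -- the generic three-fold splitting, for fixed `l`, `r` ranges
  have hsplit : ∀ SM SN SQ : Finset ℕ,
      deltaStarSets a z (IM₂ \ IM₁) SN IL₂ SQ IR₂ ≤
        deltaStarSets a z IM₂ SN IL₂ SQ IR₂ + deltaStarSets a z IM₁ SN IL₂ SQ IR₂ :=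
    fun SM SN SQ => deltaStarSets_sdiff_M_le a z (Icc_floor_subset hM) _ _ _ _
  have hsplitN : ∀ SM SQ : Finset ℕ,
      deltaStarSets a z SM (IN₂ \ IN₁) IL₂ SQ IR₂ ≤
        deltaStarSets a z SM IN₂ IL₂ SQ IR₂ + deltaStarSets a z SM IN₁ IL₂ SQ IR₂ :=
    fun SM SQ => deltaStarSets_sdiff_N_le a z SM (Icc_floor_subset hN) _ _ _
  have hsplitQ : ∀ SM SN : Finset ℕ,
      deltaStarSets a z SM SN IL₂ (IQ₂ \ IQ₁) IR₂ ≤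
        deltaStarSets a z SM SN IL₂ IQ₂ IR₂ + deltaStarSets a z SM SN IL₂ IQ₁ IR₂ :=
    fun SM SN => deltaStarSets_sdiff_Q_le a z SM SN _ _ (Icc_floor_subset hQ)
  have h1 := hsplit (IM₂ \ IM₁) (IN₂ \ IN₁) (IQ₂ \ IQ₁)
  have h2 := hsplitN IM₂ (IQ₂ \ IQ₁)
  have h3 := hsplitN IM₁ (IQ₂ \ IQ₁)
  have h4 := hsplitQ IM₂ IN₂
  have h5 := hsplitQ IM₂ IN₁
  have h6 := hsplitQ IM₁ IN₂
  have h7 := hsplitQ IM₁ IN₁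
  linarith

/-! ### Dyadic decomposition of an initial range -/

/-- Splitting an initial range of `m` at `X₁ ≤ X₂`: `Δ_sets([1,⌊X₂⌋]) ≤ Δ_sets([1,⌊X₁⌋]) + Δ_sets((⌊X₁⌋,⌊X₂⌋])`.
[folklore] -/
theorem deltaStarSets_Icc_split_M_le (a : ℤ) (z : ℝ) {X₁ X₂ : ℝ} (h : X₁ ≤ X₂) (SN SL SQ SR : Finset ℕ) :
    deltaStarSets a z (Icc 1 ⌊X₂⌋₊) SN SL SQ SR ≤
      deltaStarSets a z (Icc 1 ⌊X₁⌋₊) SN SL SQ SR + deltaStarSets a z (Ioc ⌊X₁⌋₊ ⌊X₂⌋₊) SN SL SQ SR := by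
  have hd : Disjoint (Icc 1 ⌊X₁⌋₊) (Ioc ⌊X₁⌋₊ ⌊X₂⌋₊) := by
    rw [Finset.disjoint_left]; intro m h1 h2
    rw [Finset.mem_Icc] at h1; rw [Finset.mem_Ioc] at h2; omega
  have hu : Icc 1 ⌊X₂⌋₊ = Icc 1 ⌊X₁⌋₊ ∪ Ioc ⌊X₁⌋₊ ⌊X₂⌋₊ := by
    ext m
    simp only [Finset.mem_union, Finset.mem_Icc, Finset.mem_Ioc]
    have := Nat.floor_mono h
    omega
  rw [hu]
  exact deltaStarSets_union_M_le a z hd SN SL SQ SR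

/-- Splitting an initial range of `n` at `X₁ ≤ X₂`. [folklore] -/
theorem deltaStarSets_Icc_split_N_le (a : ℤ) (z : ℝ) (SM : Finset ℕ) {X₁ X₂ : ℝ} (h : X₁ ≤ X₂) (SL SQ SR : Finset ℕ) :
    deltaStarSets a z SM (Icc 1 ⌊X₂⌋₊) SL SQ SR ≤
      deltaStarSets a z SM (Icc 1 ⌊X₁⌋₊) SL SQ SR + deltaStarSets a z SM (Ioc ⌊X₁⌋₊ ⌊X₂⌋₊) SL SQ SR := by
  have hd : Disjoint (Icc 1 ⌊X₁⌋₊) (Ioc ⌊X₁⌋₊ ⌊X₂⌋₊) := by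
    rw [Finset.disjoint_left]; intro m h1 h2
    rw [Finset.mem_Icc] at h1; rw [Finset.mem_Ioc] at h2; omega
  have hu : Icc 1 ⌊X₂⌋₊ = Icc 1 ⌊X₁⌋₊ ∪ Ioc ⌊X₁⌋₊ ⌊X₂⌋₊ := by
    ext m
    simp only [Finset.mem_union, Finset.mem_Icc, Finset.mem_Ioc]
    have := Nat.floor_mono h
    omega
  rw [hu]
  exact deltaStarSets_union_N_le a z SM hd SL SQ SR

/-- Splitting an initial range of `q` at `X₁ ≤ X₂`. [folklore] -/
theorem deltaStarSets_Icc_split_Q_le (a : ℤ) (z : ℝ) (SM SN SL SR : Finset ℕ) {X₁ X₂ : ℝ} (h : X₁ ≤ X₂) :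
    deltaStarSets a z SM SN SL (Icc 1 ⌊X₂⌋₊) SR ≤
      deltaStarSets a z SM SN SL (Icc 1 ⌊X₁⌋₊) SR + deltaStarSets a z SM SN SL (Ioc ⌊X₁⌋₊ ⌊X₂⌋₊) SR := by
  have hd : Disjoint (Icc 1 ⌊X₁⌋₊) (Ioc ⌊X₁⌋₊ ⌊X₂⌋₊) := by
    rw [Finset.disjoint_left]; intro m h1 h2
    rw [Finset.mem_Icc] at h1; rw [Finset.mem_Ioc] at h2; omega
  have hu : Icc 1 ⌊X₂⌋₊ = Icc 1 ⌊X₁⌋₊ ∪ Ioc ⌊X₁⌋₊ ⌊X₂⌋₊ := by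
    ext m
    simp only [Finset.mem_union, Finset.mem_Icc, Finset.mem_Ioc]
    have := Nat.floor_mono h
    omega
  rw [hu]
  exact deltaStarSets_union_Q_le a z SM SN SL SR hd

/-- Splitting an initial range of `l` at `X₁ ≤ X₂` (exact). [folklore] -/
theorem deltaStarSets_Icc_split_L (a : ℤ) (z : ℝ) (SM SN : Finset ℕ) {X₁ X₂ : ℝ} (h : X₁ ≤ X₂) (SQ SR : Finset ℕ) :
    deltaStarSets a z SM SN (Icc 1 ⌊X₂⌋₊) SQ SR =
      deltaStarSets a z SM SN (Icc 1 ⌊X₁⌋₊) SQ SR + deltaStarSets a z SM SN (Ioc ⌊X₁⌋₊ ⌊X₂⌋₊) SQ SR := by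
  have hd : Disjoint (Icc 1 ⌊X₁⌋₊) (Ioc ⌊X₁⌋₊ ⌊X₂⌋₊) := by
    rw [Finset.disjoint_left]; intro m h1 h2
    rw [Finset.mem_Icc] at h1; rw [Finset.mem_Ioc] at h2; omega
  have hu : Icc 1 ⌊X₂⌋₊ = Icc 1 ⌊X₁⌋₊ ∪ Ioc ⌊X₁⌋₊ ⌊X₂⌋₊ := by
    ext m
    simp only [Finset.mem_union, Finset.mem_Icc, Finset.mem_Ioc]
    have := Nat.floor_mono h
    omega
  rw [hu]
  exact deltaStarSets_union_L a z SM SN SQ SR hd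

/-- Splitting an initial range of `r` at `X₁ ≤ X₂` (exact). [folklore] -/
theorem deltaStarSets_Icc_split_R (a : ℤ) (z : ℝ) (SM SN SL SQ : Finset ℕ) {X₁ X₂ : ℝ} (h : X₁ ≤ X₂) :
    deltaStarSets a z SM SN SL SQ (Icc 1 ⌊X₂⌋₊) =
      deltaStarSets a z SM SN SL SQ (Icc 1 ⌊X₁⌋₊) + deltaStarSets a z SM SN SL SQ (Ioc ⌊X₁⌋₊ ⌊X₂⌋₊) := by
  have hd : Disjoint (Icc 1 ⌊X₁⌋₊) (Ioc ⌊X₁⌋₊ ⌊X₂⌋₊) := by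
    rw [Finset.disjoint_left]; intro m h1 h2
    rw [Finset.mem_Icc] at h1; rw [Finset.mem_Ioc] at h2; omega
  have hu : Icc 1 ⌊X₂⌋₊ = Icc 1 ⌊X₁⌋₊ ∪ Ioc ⌊X₁⌋₊ ⌊X₂⌋₊ := by
    ext m
    simp only [Finset.mem_union, Finset.mem_Icc, Finset.mem_Ioc]
    have := Nat.floor_mono h
    omega
  rw [hu]
  exact deltaStarSets_union_R a z SM SN SL SQ hd

/-! ### The trivial bound for a block of small product `LMN` -/

/-- `|A − B| ≤ A + B` summed: `Δ*` is at most the sum of ALL congruence counts plus all expected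
counts, over the full ranges (filters and the weight on `l` dropped). [folklore] -/
theorem deltaStar_le_parts (a : ℤ) (z M N L Q R : ℝ) :
    deltaStar a z M N L Q R ≤
      ∑ r ∈ Icc 1 ⌊R⌋₊, ∑ l ∈ Icc 1 ⌊L⌋₊, ∑ q ∈ Icc 1 ⌊Q⌋₊,
        (roughCongrCount a z M N l (q * r) + roughCoprimeCount z M N (q * r) / (Nat.totient (q * r) : ℝ)) := by
  have hA0 : ∀ l d, 0 ≤ roughCongrCount a z M N l d := fun l d =>
    Finset.sum_nonneg fun m _ => Finset.sum_nonneg fun n _ => by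
      split_ifs
      · exact mul_nonneg (roughIndicator_nonneg z m) (roughIndicator_nonneg z n)
      · exact le_rfl
  have hB0 : ∀ d, 0 ≤ roughCoprimeCount z M N d / (Nat.totient d : ℝ) := fun d =>
    div_nonneg (Finset.sum_nonneg fun m _ => Finset.sum_nonneg fun n _ => by
      split_ifs
      · exact mul_nonneg (roughIndicator_nonneg z m) (roughIndicator_nonneg z n)
      · exact le_rfl) (Nat.cast_nonneg _)
  have hρ1 : ∀ l, roughIndicator z l ≤ 1 := fun l => by unfold roughIndicator; split_ifs <;> norm_num
  have hterm : ∀ r l : ℕ, roughIndicator z l *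
      |∑ q ∈ (Icc 1 ⌊Q⌋₊).filter (fun q : ℕ => IsCoprime (q : ℤ) (a * l)),
        (roughCongrCount a z M N l (q * r) - roughCoprimeCount z M N (q * r) / (Nat.totient (q * r) : ℝ))| ≤
      ∑ q ∈ Icc 1 ⌊Q⌋₊,
        (roughCongrCount a z M N l (q * r) + roughCoprimeCount z M N (q * r) / (Nat.totient (q * r) : ℝ)) := by
    intro r l
    have hS0 : 0 ≤ ∑ q ∈ Icc 1 ⌊Q⌋₊,
        (roughCongrCount a z M N l (q * r) + roughCoprimeCount z M N (q * r) / (Nat.totient (q * r) : ℝ)) :=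
      Finset.sum_nonneg fun q _ => add_nonneg (hA0 l _) (hB0 _)
    calc _ ≤ 1 * |∑ q ∈ (Icc 1 ⌊Q⌋₊).filter (fun q : ℕ => IsCoprime (q : ℤ) (a * l)),
            (roughCongrCount a z M N l (q * r) - roughCoprimeCount z M N (q * r) / (Nat.totient (q * r) : ℝ))| :=
          mul_le_mul_of_nonneg_right (hρ1 l) (abs_nonneg _)
      _ ≤ ∑ q ∈ (Icc 1 ⌊Q⌋₊).filter (fun q : ℕ => IsCoprime (q : ℤ) (a * l)),
            |roughCongrCount a z M N l (q * r) - roughCoprimeCount z M N (q * r) / (Nat.totient (q * r) : ℝ)| := by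
          rw [one_mul]; exact Finset.abs_sum_le_sum_abs _ _
      _ ≤ ∑ q ∈ (Icc 1 ⌊Q⌋₊).filter (fun q : ℕ => IsCoprime (q : ℤ) (a * l)),
            (roughCongrCount a z M N l (q * r) + roughCoprimeCount z M N (q * r) / (Nat.totient (q * r) : ℝ)) := by
          refine Finset.sum_le_sum fun q _ => ?_
          have h1 := hA0 l (q * r); have h2 := hB0 (q * r)
          rw [abs_le]; constructor <;> linarith
      _ ≤ _ := Finset.sum_le_sum_of_subset_of_nonneg (Finset.filter_subset _ _) fun q _ _ =>
          add_nonneg (hA0 l _) (hB0 _)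
  unfold deltaStar
  calc _ ≤ ∑ r ∈ (Icc 1 ⌊R⌋₊).filter (fun r : ℕ => IsCoprime (r : ℤ) a),
          ∑ l ∈ (Icc 1 ⌊L⌋₊).filter (fun l : ℕ => l.Coprime r), ∑ q ∈ Icc 1 ⌊Q⌋₊,
            (roughCongrCount a z M N l (q * r) + roughCoprimeCount z M N (q * r) / (Nat.totient (q * r) : ℝ)) :=
        Finset.sum_le_sum fun r _ => Finset.sum_le_sum fun l _ => hterm r l
    _ ≤ ∑ r ∈ (Icc 1 ⌊R⌋₊).filter (fun r : ℕ => IsCoprime (r : ℤ) a),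
          ∑ l ∈ Icc 1 ⌊L⌋₊, ∑ q ∈ Icc 1 ⌊Q⌋₊,
            (roughCongrCount a z M N l (q * r) + roughCoprimeCount z M N (q * r) / (Nat.totient (q * r) : ℝ)) :=
        Finset.sum_le_sum fun r _ => Finset.sum_le_sum_of_subset_of_nonneg (Finset.filter_subset _ _)
          fun l _ _ => Finset.sum_nonneg fun q _ => add_nonneg (hA0 l _) (hB0 _)
    _ ≤ _ := Finset.sum_le_sum_of_subset_of_nonneg (Finset.filter_subset _ _) fun r _ _ =>
          Finset.sum_nonneg fun l _ => Finset.sum_nonneg fun q _ => add_nonneg (hA0 l _) (hB0 _)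

/-- The congruence count is at most the number of `(m, n)` in the box with `d ∣ lmn − a`. [folklore] -/
theorem roughCongrCount_le_dvd_count (a : ℤ) (z M N : ℝ) (l d : ℕ) :
    roughCongrCount a z M N l d ≤
      ∑ m ∈ Icc 1 ⌊M⌋₊, ∑ n ∈ Icc 1 ⌊N⌋₊, (if (d : ℤ) ∣ ((l * m * n : ℕ) : ℤ) - a then (1 : ℝ) else 0) := by
  unfold roughCongrCount
  refine Finset.sum_le_sum fun m _ => Finset.sum_le_sum fun n _ => ?_
  have hρ : roughIndicator z m * roughIndicator z n ≤ 1 := by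
    have h1 : roughIndicator z m ≤ 1 := by unfold roughIndicator; split_ifs <;> norm_num
    have h2 : roughIndicator z n ≤ 1 := by unfold roughIndicator; split_ifs <;> norm_num
    calc roughIndicator z m * roughIndicator z n ≤ 1 * 1 :=
          mul_le_mul h1 h2 (roughIndicator_nonneg z n) zero_le_one
      _ = 1 := one_mul 1
  by_cases h : ((l * m * n : ℕ) : ZMod d) = (a : ZMod d)
  · rw [if_pos h, if_pos]
    · exact hρ
    · have h' : (((l * m * n : ℕ) : ℤ) : ZMod d) = ((a : ℤ) : ZMod d) := by rwa [Int.cast_natCast]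
      rw [ZMod.intCast_eq_intCast_iff_dvd_sub] at h'
      -- `d ∣ a − lmn`, hence `d ∣ lmn − a`
      have := h'.neg_right
      rwa [neg_sub] at this
  · rw [if_neg h]
    split_ifs <;> norm_num

/-- The expected count is at most `⌊M⌋⌊N⌋/φ(d)`. [folklore] -/
theorem roughCoprimeCount_div_le (z M N : ℝ) (d : ℕ) :
    roughCoprimeCount z M N d / (Nat.totient d : ℝ) ≤ (⌊M⌋₊ : ℝ) * ⌊N⌋₊ * ((Nat.totient d : ℝ))⁻¹ := by
  rw [div_eq_mul_inv]
  refine mul_le_mul_of_nonneg_right ?_ (inv_nonneg.2 (Nat.cast_nonneg _))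
  unfold roughCoprimeCount
  have hρ : ∀ m n, (if (m * n).Coprime d then roughIndicator z m * roughIndicator z n else 0) ≤ (1 : ℝ) := by
    intro m n
    have h1 : roughIndicator z m ≤ 1 := by unfold roughIndicator; split_ifs <;> norm_num
    have h2 : roughIndicator z n ≤ 1 := by unfold roughIndicator; split_ifs <;> norm_num
    split_ifs
    · calc roughIndicator z m * roughIndicator z n ≤ 1 * 1 :=
            mul_le_mul h1 h2 (roughIndicator_nonneg z n) zero_le_one
        _ = 1 := one_mul 1
    · norm_num
  calc ∑ m ∈ Icc 1 ⌊M⌋₊, ∑ n ∈ Icc 1 ⌊N⌋₊, (if (m * n).Coprime d then roughIndicator z m * roughIndicator z n else 0)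
      ≤ ∑ m ∈ Icc 1 ⌊M⌋₊, ∑ _n ∈ Icc 1 ⌊N⌋₊, (1 : ℝ) := Finset.sum_le_sum fun m _ => Finset.sum_le_sum fun n _ => hρ m n
    _ = (⌊M⌋₊ : ℝ) * ⌊N⌋₊ := by
        simp only [Finset.sum_const, Nat.card_Icc, Nat.add_sub_cancel, nsmul_eq_mul, mul_one]

/-- For `K ≠ 0`, the pairs `(q, r)` with `qr ∣ K` number at most `τ(|K|)²`; for `K = 0` at most all pairs. [folklore] -/
theorem sum_sum_dvd_indicator_le (Q' R' : ℕ) (K : ℤ) :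
    ∑ q ∈ Icc 1 Q', ∑ r ∈ Icc 1 R', (if ((q * r : ℕ) : ℤ) ∣ K then (1 : ℝ) else 0) ≤
      if K = 0 then (Q' : ℝ) * R' else (σ 0 K.natAbs : ℝ) ^ 2 := by
  by_cases hK : K = 0
  · rw [if_pos hK]
    calc ∑ q ∈ Icc 1 Q', ∑ r ∈ Icc 1 R', (if ((q * r : ℕ) : ℤ) ∣ K then (1 : ℝ) else 0)
        ≤ ∑ q ∈ Icc 1 Q', ∑ _r ∈ Icc 1 R', (1 : ℝ) :=
          Finset.sum_le_sum fun q _ => Finset.sum_le_sum fun r _ => by split_ifs <;> norm_num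
      _ = (Q' : ℝ) * R' := by
          simp only [Finset.sum_const, Nat.card_Icc, Nat.add_sub_cancel, nsmul_eq_mul, mul_one]
  · rw [if_neg hK]
    have hKn : K.natAbs ≠ 0 := Int.natAbs_ne_zero.2 hK
    -- the set of pairs injects into `divisors |K| × divisors |K|`
    rw [← Finset.sum_product']
    rw [show ∑ x ∈ Icc 1 Q' ×ˢ Icc 1 R', (if ((x.1 * x.2 : ℕ) : ℤ) ∣ K then (1 : ℝ) else 0) =
        ((Icc 1 Q' ×ˢ Icc 1 R').filter (fun x : ℕ × ℕ => ((x.1 * x.2 : ℕ) : ℤ) ∣ K)).card by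
      rw [Finset.card_eq_sum_ones, Nat.cast_sum, Finset.sum_filter]; push_cast; rfl]
    have hcard : ((Icc 1 Q' ×ˢ Icc 1 R').filter (fun x : ℕ × ℕ => ((x.1 * x.2 : ℕ) : ℤ) ∣ K)).card ≤
        (K.natAbs.divisors ×ˢ K.natAbs.divisors).card := by
      refine Finset.card_le_card_of_injOn id (fun x hx => ?_) (Set.injOn_id _)
      rw [Finset.coe_filter] at hx
      obtain ⟨-, hdvd⟩ := hx
      have h1 : x.1 * x.2 ∣ K.natAbs := by
        have := Int.natAbs_dvd_natAbs.2 hdvd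
        rwa [Int.natAbs_natCast] at this
      show x ∈ K.natAbs.divisors ×ˢ K.natAbs.divisors
      rw [Finset.mem_product, Nat.mem_divisors, Nat.mem_divisors]
      exact ⟨⟨Nat.dvd_trans (Nat.dvd_mul_right _ _) h1, hKn⟩, ⟨Nat.dvd_trans (Nat.dvd_mul_left _ _) h1, hKn⟩⟩
    calc (((Icc 1 Q' ×ˢ Icc 1 R').filter (fun x : ℕ × ℕ => ((x.1 * x.2 : ℕ) : ℤ) ∣ K)).card : ℝ)
        ≤ ((K.natAbs.divisors ×ˢ K.natAbs.divisors).card : ℝ) := by exact_mod_cast hcard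
      _ = (σ 0 K.natAbs : ℝ) ^ 2 := by
          rw [Finset.card_product, ArithmeticFunction.sigma_zero_apply]; push_cast; ring

/-- The number of ways to write `k` as `l · m · n` with `l, m, n ≥ 1` in boxes is at most `τ(k)²`. [folklore] -/
theorem card_triples_le {k : ℕ} (hk : k ≠ 0) (IL IM IN : Finset ℕ) :
    ((IL ×ˢ (IM ×ˢ IN)).filter (fun p : ℕ × (ℕ × ℕ) => p.1 * p.2.1 * p.2.2 = k)).card ≤ k.divisors.card ^ 2 := by
  rw [sq, ← Finset.card_product]
  refine Finset.card_le_card_of_injOn (fun p => (p.1, p.2.1)) (fun p hp => ?_) ?_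
  · rw [Finset.coe_filter] at hp
    obtain ⟨-, hp⟩ := hp
    show (p.1, p.2.1) ∈ k.divisors ×ˢ k.divisors
    rw [Finset.mem_product, Nat.mem_divisors, Nat.mem_divisors]
    refine ⟨⟨⟨p.2.1 * p.2.2, by rw [← hp]; ring⟩, hk⟩, ⟨⟨p.1 * p.2.2, by rw [← hp]; ring⟩, hk⟩⟩
  · intro p₁ hp₁ p₂ hp₂ h
    rw [Finset.coe_filter] at hp₁ hp₂
    simp only [Prod.mk.injEq] at h
    have hk1 : p₁.1 * p₁.2.1 ≠ 0 := by
      intro h0; apply hk; rw [← hp₁.2, h0, zero_mul]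
    have h3 : p₁.2.2 = p₂.2.2 := by
      apply Nat.eq_of_mul_eq_mul_left (Nat.pos_of_ne_zero hk1)
      rw [hp₁.2, h.1, h.2, hp₂.2]
    exact Prod.ext h.1 (Prod.ext h.2 h3)

/-- Sums of `τ(|k − a|)⁴` over `k ≤ X` against sums of `τ(j)⁴` over `j ≤ X + |a|` (each `j` arises
from at most two `k`). [folklore] -/
theorem sum_sigma_shift_le (a : ℤ) (X : ℕ) :
    ∑ k ∈ Icc 1 X, (σ 0 ((k : ℤ) - a).natAbs : ℝ) ^ 4 ≤ 2 * ∑ j ∈ Icc 1 (X + a.natAbs), (σ 0 j : ℝ) ^ 4 := by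
  classical
  rw [Finset.sum_comp (fun j : ℕ => (σ 0 j : ℝ) ^ 4) (fun k : ℕ => ((k : ℤ) - a).natAbs)]
  have hfib : ∀ j : ℕ, (((Icc 1 X).filter (fun k : ℕ => ((k : ℤ) - a).natAbs = j)).card : ℝ) ≤ 2 := by
    intro j
    have hsub : (Icc 1 X).filter (fun k : ℕ => ((k : ℤ) - a).natAbs = j) ⊆ {(a + j).toNat, (a - j).toNat} := by
      intro k hk
      rw [Finset.mem_filter] at hk
      rw [Finset.mem_insert, Finset.mem_singleton]
      rcases Int.natAbs_eq_iff.1 hk.2 with h | h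
      · left; omega
      · right; omega
    calc (((Icc 1 X).filter (fun k : ℕ => ((k : ℤ) - a).natAbs = j)).card : ℝ)
        ≤ (({(a + j).toNat, (a - j).toNat} : Finset ℕ).card : ℝ) := by exact_mod_cast Finset.card_le_card hsub
      _ ≤ 2 := by exact_mod_cast Finset.card_le_two
  calc ∑ j ∈ (Icc 1 X).image (fun k : ℕ => ((k : ℤ) - a).natAbs),
        ((Icc 1 X).filter (fun k : ℕ => ((k : ℤ) - a).natAbs = j)).card • (σ 0 j : ℝ) ^ 4
      ≤ ∑ j ∈ (Icc 1 X).image (fun k : ℕ => ((k : ℤ) - a).natAbs), 2 * (σ 0 j : ℝ) ^ 4 := by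
        refine Finset.sum_le_sum fun j _ => ?_
        rw [nsmul_eq_mul]
        exact mul_le_mul_of_nonneg_right (hfib j) (by positivity)
    _ = 2 * ∑ j ∈ (Icc 1 X).image (fun k : ℕ => ((k : ℤ) - a).natAbs), (σ 0 j : ℝ) ^ 4 := by rw [Finset.mul_sum]
    _ ≤ 2 * ∑ j ∈ insert 0 (Icc 1 (X + a.natAbs)), (σ 0 j : ℝ) ^ 4 := by
        refine mul_le_mul_of_nonneg_left (Finset.sum_le_sum_of_subset_of_nonneg ?_ fun j _ _ => by positivity)
          (by norm_num)
        intro j hj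
        rw [Finset.mem_image] at hj
        obtain ⟨k, hk, rfl⟩ := hj
        rw [Finset.mem_Icc] at hk
        rw [Finset.mem_insert, Finset.mem_Icc]
        by_cases h0 : ((k : ℤ) - a).natAbs = 0
        · left; exact h0
        · right
          refine ⟨Nat.one_le_iff_ne_zero.2 h0, ?_⟩
          have : (((k : ℤ) - a).natAbs : ℤ) ≤ k + a.natAbs := by
            rw [Int.natCast_natAbs, Int.natCast_natAbs]
            exact (abs_sub _ _).trans (by simp)
          omega
    _ = 2 * ∑ j ∈ Icc 1 (X + a.natAbs), (σ 0 j : ℝ) ^ 4 := by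
        rw [Finset.sum_insert (by simp)]
        simp

/-- **The trivial bound for `Δ*`, uniform in the ranges** (used for blocks of small product
`LMN`): with an absolute `C`,
`Δ*(M,N,L,Q,R) ≤ C (X + |a| + 2) log³²(X + |a| + 2) + τ(|a|)² ⌊Q⌋⌊R⌋ + X (1 + log⌊Q⌋)² (1 + log⌊R⌋)²`,
`X = ⌊L⌋⌊M⌋⌊N⌋`: the congruence counts are bounded through `#{(q, r) : qr ∣ lmn − a} ≤ τ(|lmn − a|)²`
(and all pairs when `lmn = a`), the multiplicity of `k = lmn` by `τ(k)²`, `2xy ≤ x² + y²` and the fourth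
moment of `τ`; the expected counts through `φ(qr) ≥ φ(q)φ(r)` and `∑_{d ≤ D} 1/φ(d) ≤ (1 + log D)²`.
[cite: BombieriFriedlanderIwaniecActa1986, §14 p. 244] -/
theorem deltaStar_uniform_trivial :
    ∃ C : ℝ, 0 < C ∧ ∀ (a : ℤ) (z M N L Q R : ℝ),
      deltaStar a z M N L Q R ≤
        C * ((⌊L⌋₊ * ⌊M⌋₊ * ⌊N⌋₊ : ℕ) + |(a : ℝ)| + 2) *
            Real.log ((⌊L⌋₊ * ⌊M⌋₊ * ⌊N⌋₊ : ℕ) + |(a : ℝ)| + 2) ^ 32 +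
          (σ 0 a.natAbs : ℝ) ^ 2 * ⌊Q⌋₊ * ⌊R⌋₊ +
          ((⌊L⌋₊ * ⌊M⌋₊ * ⌊N⌋₊ : ℕ) : ℝ) * (1 + Real.log ⌊Q⌋₊) ^ 2 * (1 + Real.log ⌊R⌋₊) ^ 2 := by
  classical
  obtain ⟨C₄, hC₄, h₄⟩ := exists_sum_sigma_zero_pow_le 4
  refine ⟨3 * C₄, by positivity, fun a z M N L Q R => ?_⟩
  set L' := ⌊L⌋₊; set M' := ⌊M⌋₊; set N' := ⌊N⌋₊; set Q' := ⌊Q⌋₊; set R' := ⌊R⌋₊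
  set X : ℕ := L' * M' * N' with hX
  set Y : ℝ := (X : ℝ) + |(a : ℝ)| + 2 with hY
  have hY2 : 2 ≤ Y := by
    rw [hY]; have h1 := abs_nonneg (a : ℝ); have h2 : (0 : ℝ) ≤ X := Nat.cast_nonneg X; linarith
  have hlogY : 0 ≤ Real.log Y := Real.log_nonneg (by linarith)
  -- Step 1: congruence + expected parts
  refine (deltaStar_le_parts a z M N L Q R).trans ?_
  rw [show ∑ r ∈ Icc 1 R', ∑ l ∈ Icc 1 L', ∑ q ∈ Icc 1 Q',
      (roughCongrCount a z M N l (q * r) + roughCoprimeCount z M N (q * r) / (Nat.totient (q * r) : ℝ)) =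
      (∑ r ∈ Icc 1 R', ∑ l ∈ Icc 1 L', ∑ q ∈ Icc 1 Q', roughCongrCount a z M N l (q * r)) +
      ∑ r ∈ Icc 1 R', ∑ l ∈ Icc 1 L', ∑ q ∈ Icc 1 Q', roughCoprimeCount z M N (q * r) / (Nat.totient (q * r) : ℝ) by
    simp only [Finset.sum_add_distrib]]
  -- Step 2: the expected part
  have hB : ∑ r ∈ Icc 1 R', ∑ l ∈ Icc 1 L', ∑ q ∈ Icc 1 Q',
      roughCoprimeCount z M N (q * r) / (Nat.totient (q * r) : ℝ) ≤
      (X : ℝ) * (1 + Real.log Q') ^ 2 * (1 + Real.log R') ^ 2 := by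
    have hφ : ∀ q r : ℕ, 1 ≤ q → 1 ≤ r → ((Nat.totient (q * r) : ℝ))⁻¹ ≤ ((Nat.totient q : ℝ))⁻¹ * ((Nat.totient r : ℝ))⁻¹ := by
      intro q r hq hr
      have hq0 : (0 : ℝ) < Nat.totient q := by exact_mod_cast Nat.totient_pos.2 hq
      have hr0 : (0 : ℝ) < Nat.totient r := by exact_mod_cast Nat.totient_pos.2 hr
      rw [← mul_inv, inv_le_inv₀ (by exact_mod_cast Nat.totient_pos.2 (Nat.mul_pos hq hr)) (mul_pos hq0 hr0)]
      exact_mod_cast Nat.totient_super_multiplicative q r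
    have hid : ∀ f g : ℕ → ℝ, ∑ r ∈ Icc 1 R', ∑ _l ∈ Icc 1 L', ∑ q ∈ Icc 1 Q', f q * g r =
        (L' : ℝ) * ((∑ q ∈ Icc 1 Q', f q) * (∑ r ∈ Icc 1 R', g r)) := by
      intro f g
      rw [Finset.sum_mul_sum]
      simp only [Finset.sum_const, Nat.card_Icc, Nat.add_sub_cancel, nsmul_eq_mul]
      rw [← Finset.mul_sum, Finset.sum_comm]
    calc ∑ r ∈ Icc 1 R', ∑ l ∈ Icc 1 L', ∑ q ∈ Icc 1 Q', roughCoprimeCount z M N (q * r) / (Nat.totient (q * r) : ℝ)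
        ≤ ∑ r ∈ Icc 1 R', ∑ _l ∈ Icc 1 L', ∑ q ∈ Icc 1 Q',
            ((M' : ℝ) * N' * ((Nat.totient q : ℝ))⁻¹) * ((Nat.totient r : ℝ))⁻¹ := by
          refine Finset.sum_le_sum fun r hr => Finset.sum_le_sum fun l _ => Finset.sum_le_sum fun q hq => ?_
          rw [Finset.mem_Icc] at hr hq
          rw [mul_assoc]
          exact (roughCoprimeCount_div_le z M N _).trans
            (mul_le_mul_of_nonneg_left (hφ q r hq.1 hr.1) (by positivity))
      _ = (L' : ℝ) * ((∑ q ∈ Icc 1 Q', (M' : ℝ) * N' * ((Nat.totient q : ℝ))⁻¹) *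
            (∑ r ∈ Icc 1 R', ((Nat.totient r : ℝ))⁻¹)) := hid _ _
      _ = (L' : ℝ) * ((M' : ℝ) * N') * ((∑ q ∈ Icc 1 Q', ((Nat.totient q : ℝ))⁻¹) *
            ∑ r ∈ Icc 1 R', ((Nat.totient r : ℝ))⁻¹) := by rw [← Finset.mul_sum]; ring
      _ ≤ (L' : ℝ) * ((M' : ℝ) * N') * ((1 + Real.log Q') ^ 2 * (1 + Real.log R') ^ 2) := by
          refine mul_le_mul_of_nonneg_left (mul_le_mul (totientInvSum_le Q') (totientInvSum_le R')
            (Finset.sum_nonneg fun r _ => inv_nonneg.2 (Nat.cast_nonneg _)) (by positivity)) (by positivity)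
      _ = (X : ℝ) * (1 + Real.log Q') ^ 2 * (1 + Real.log R') ^ 2 := by rw [hX]; push_cast; ring
  -- Step 3: the congruence part, `≤ ∑_{l,m,n} G(lmn)`
  set G : ℕ → ℝ := fun k => if (k : ℤ) = a then (Q' : ℝ) * R' else (σ 0 ((k : ℤ) - a).natAbs : ℝ) ^ 2 with hG
  have hG0 : ∀ k, 0 ≤ G k := fun k => by simp only [hG]; split_ifs <;> positivity
  have hA1 : ∑ r ∈ Icc 1 R', ∑ l ∈ Icc 1 L', ∑ q ∈ Icc 1 Q', roughCongrCount a z M N l (q * r) ≤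
      ∑ l ∈ Icc 1 L', ∑ m ∈ Icc 1 M', ∑ n ∈ Icc 1 N', G (l * m * n) := by
    calc ∑ r ∈ Icc 1 R', ∑ l ∈ Icc 1 L', ∑ q ∈ Icc 1 Q', roughCongrCount a z M N l (q * r)
        ≤ ∑ r ∈ Icc 1 R', ∑ l ∈ Icc 1 L', ∑ q ∈ Icc 1 Q', ∑ m ∈ Icc 1 M', ∑ n ∈ Icc 1 N',
            (if ((q * r : ℕ) : ℤ) ∣ ((l * m * n : ℕ) : ℤ) - a then (1 : ℝ) else 0) :=
          Finset.sum_le_sum fun r _ => Finset.sum_le_sum fun l _ => Finset.sum_le_sum fun q _ =>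
            roughCongrCount_le_dvd_count a z M N l (q * r)
      _ = ∑ l ∈ Icc 1 L', ∑ r ∈ Icc 1 R', ∑ q ∈ Icc 1 Q', ∑ m ∈ Icc 1 M', ∑ n ∈ Icc 1 N',
            (if ((q * r : ℕ) : ℤ) ∣ ((l * m * n : ℕ) : ℤ) - a then (1 : ℝ) else 0) := Finset.sum_comm
      _ = ∑ l ∈ Icc 1 L', ∑ m ∈ Icc 1 M', ∑ r ∈ Icc 1 R', ∑ q ∈ Icc 1 Q', ∑ n ∈ Icc 1 N',
            (if ((q * r : ℕ) : ℤ) ∣ ((l * m * n : ℕ) : ℤ) - a then (1 : ℝ) else 0) := by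
          refine Finset.sum_congr rfl fun l _ => ?_
          calc ∑ r ∈ Icc 1 R', ∑ q ∈ Icc 1 Q', ∑ m ∈ Icc 1 M', ∑ n ∈ Icc 1 N',
                (if ((q * r : ℕ) : ℤ) ∣ ((l * m * n : ℕ) : ℤ) - a then (1 : ℝ) else 0)
              = ∑ r ∈ Icc 1 R', ∑ m ∈ Icc 1 M', ∑ q ∈ Icc 1 Q', ∑ n ∈ Icc 1 N',
                (if ((q * r : ℕ) : ℤ) ∣ ((l * m * n : ℕ) : ℤ) - a then (1 : ℝ) else 0) :=
                Finset.sum_congr rfl fun r _ => Finset.sum_comm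
            _ = _ := Finset.sum_comm
      _ = ∑ l ∈ Icc 1 L', ∑ m ∈ Icc 1 M', ∑ n ∈ Icc 1 N', ∑ q ∈ Icc 1 Q', ∑ r ∈ Icc 1 R',
            (if ((q * r : ℕ) : ℤ) ∣ ((l * m * n : ℕ) : ℤ) - a then (1 : ℝ) else 0) := by
          refine Finset.sum_congr rfl fun l _ => Finset.sum_congr rfl fun m _ => ?_
          calc ∑ r ∈ Icc 1 R', ∑ q ∈ Icc 1 Q', ∑ n ∈ Icc 1 N',
                (if ((q * r : ℕ) : ℤ) ∣ ((l * m * n : ℕ) : ℤ) - a then (1 : ℝ) else 0)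
              = ∑ r ∈ Icc 1 R', ∑ n ∈ Icc 1 N', ∑ q ∈ Icc 1 Q',
                (if ((q * r : ℕ) : ℤ) ∣ ((l * m * n : ℕ) : ℤ) - a then (1 : ℝ) else 0) :=
                Finset.sum_congr rfl fun r _ => Finset.sum_comm
            _ = ∑ n ∈ Icc 1 N', ∑ r ∈ Icc 1 R', ∑ q ∈ Icc 1 Q',
                (if ((q * r : ℕ) : ℤ) ∣ ((l * m * n : ℕ) : ℤ) - a then (1 : ℝ) else 0) := Finset.sum_comm
            _ = _ := Finset.sum_congr rfl fun n _ => Finset.sum_comm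
      _ ≤ ∑ l ∈ Icc 1 L', ∑ m ∈ Icc 1 M', ∑ n ∈ Icc 1 N', G (l * m * n) := by
          refine Finset.sum_le_sum fun l _ => Finset.sum_le_sum fun m _ => Finset.sum_le_sum fun n _ => ?_
          have hswap : ∑ q ∈ Icc 1 Q', ∑ r ∈ Icc 1 R',
              (if ((q * r : ℕ) : ℤ) ∣ ((l * m * n : ℕ) : ℤ) - a then (1 : ℝ) else 0) ≤
              if ((l * m * n : ℕ) : ℤ) - a = 0 then (Q' : ℝ) * R' else
                (σ 0 (((l * m * n : ℕ) : ℤ) - a).natAbs : ℝ) ^ 2 := sum_sum_dvd_indicator_le Q' R' _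
          refine hswap.trans (le_of_eq ?_)
          simp only [hG, sub_eq_zero]
  -- Step 4: fibres of `(l, m, n) ↦ lmn`
  have hA2 : ∑ l ∈ Icc 1 L', ∑ m ∈ Icc 1 M', ∑ n ∈ Icc 1 N', G (l * m * n) ≤
      ∑ k ∈ Icc 1 X, (σ 0 k : ℝ) ^ 2 * G k := by
    set P : Finset (ℕ × (ℕ × ℕ)) := Icc 1 L' ×ˢ (Icc 1 M' ×ˢ Icc 1 N') with hP
    have hsumP : ∑ l ∈ Icc 1 L', ∑ m ∈ Icc 1 M', ∑ n ∈ Icc 1 N', G (l * m * n) =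
        ∑ p ∈ P, G (p.1 * p.2.1 * p.2.2) := by
      rw [hP, Finset.sum_product]
      exact Finset.sum_congr rfl fun l _ => by rw [Finset.sum_product]
    rw [hsumP, Finset.sum_comp G (fun p : ℕ × (ℕ × ℕ) => p.1 * p.2.1 * p.2.2)]
    have hmem : ∀ k ∈ P.image (fun p : ℕ × (ℕ × ℕ) => p.1 * p.2.1 * p.2.2), k ∈ Icc 1 X ∧ k ≠ 0 := by
      intro k hk
      rw [Finset.mem_image] at hk
      obtain ⟨p, hp, rfl⟩ := hk
      rw [hP, Finset.mem_product, Finset.mem_product, Finset.mem_Icc, Finset.mem_Icc, Finset.mem_Icc] at hp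
      have h1 : 1 ≤ p.1 * p.2.1 * p.2.2 := Nat.one_le_iff_ne_zero.2 (by
        refine mul_ne_zero (mul_ne_zero ?_ ?_) ?_ <;> omega)
      refine ⟨Finset.mem_Icc.2 ⟨h1, ?_⟩, by omega⟩
      rw [hX]; exact Nat.mul_le_mul (Nat.mul_le_mul hp.1.2 hp.2.1.2) hp.2.2.2
    calc ∑ k ∈ P.image (fun p : ℕ × (ℕ × ℕ) => p.1 * p.2.1 * p.2.2),
          (P.filter (fun p : ℕ × (ℕ × ℕ) => p.1 * p.2.1 * p.2.2 = k)).card • G k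
        ≤ ∑ k ∈ P.image (fun p : ℕ × (ℕ × ℕ) => p.1 * p.2.1 * p.2.2), (σ 0 k : ℝ) ^ 2 * G k := by
          refine Finset.sum_le_sum fun k hk => ?_
          rw [nsmul_eq_mul]
          refine mul_le_mul_of_nonneg_right ?_ (hG0 k)
          have := card_triples_le (hmem k hk).2 (Icc 1 L') (Icc 1 M') (Icc 1 N')
          rw [← hP] at this
          calc ((P.filter (fun p : ℕ × (ℕ × ℕ) => p.1 * p.2.1 * p.2.2 = k)).card : ℝ)
              ≤ ((k.divisors.card ^ 2 : ℕ) : ℝ) := by exact_mod_cast this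
            _ = (σ 0 k : ℝ) ^ 2 := by rw [ArithmeticFunction.sigma_zero_apply]; push_cast; ring
      _ ≤ ∑ k ∈ Icc 1 X, (σ 0 k : ℝ) ^ 2 * G k :=
          Finset.sum_le_sum_of_subset_of_nonneg (fun k hk => (hmem k hk).1) fun k _ _ =>
            mul_nonneg (by positivity) (hG0 k)
  -- Step 5: `τ(k)² G(k) ≤ τ(|a|)² Q'R' 1_{k=a} + τ(k)⁴ + τ(|k−a|)⁴`, and the fourth moments
  have hA3 : ∑ k ∈ Icc 1 X, (σ 0 k : ℝ) ^ 2 * G k ≤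
      (σ 0 a.natAbs : ℝ) ^ 2 * Q' * R' + 3 * C₄ * Y * Real.log Y ^ 32 := by
    have hpt : ∀ k ∈ Icc 1 X, (σ 0 k : ℝ) ^ 2 * G k ≤
        (if (k : ℤ) = a then (σ 0 a.natAbs : ℝ) ^ 2 * Q' * R' else 0) +
          ((σ 0 k : ℝ) ^ 4 + (σ 0 ((k : ℤ) - a).natAbs : ℝ) ^ 4) := by
      intro k _
      simp only [hG]
      by_cases hka : (k : ℤ) = a
      · simp only [hka, if_true]
        have : a.natAbs = k := by rw [← hka, Int.natAbs_natCast]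
        rw [this]
        have h0 : 0 ≤ (σ 0 k : ℝ) ^ 4 + (σ 0 ((k : ℤ) - (k : ℤ)).natAbs : ℝ) ^ 4 := by positivity
        rw [← hka]
        nlinarith [h0]
      · simp only [hka, if_false, zero_add]
        nlinarith [sq_nonneg ((σ 0 k : ℝ) ^ 2 - (σ 0 ((k : ℤ) - a).natAbs : ℝ) ^ 2)]
    refine (Finset.sum_le_sum hpt).trans ?_
    rw [Finset.sum_add_distrib, Finset.sum_add_distrib]
    -- the `k = a` term
    have hka : ∑ k ∈ Icc 1 X, (if (k : ℤ) = a then (σ 0 a.natAbs : ℝ) ^ 2 * Q' * R' else 0) ≤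
        (σ 0 a.natAbs : ℝ) ^ 2 * Q' * R' := by
      rw [← Finset.sum_filter]
      have hcard : ((Icc 1 X).filter (fun k : ℕ => (k : ℤ) = a)).card ≤ 1 := by
        refine Finset.card_le_one.2 fun k₁ hk₁ k₂ hk₂ => ?_
        rw [Finset.mem_filter] at hk₁ hk₂
        exact_mod_cast hk₁.2.trans hk₂.2.symm
      rw [Finset.sum_const, nsmul_eq_mul]
      calc (((Icc 1 X).filter (fun k : ℕ => (k : ℤ) = a)).card : ℝ) * ((σ 0 a.natAbs : ℝ) ^ 2 * Q' * R')
          ≤ 1 * ((σ 0 a.natAbs : ℝ) ^ 2 * Q' * R') :=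
            mul_le_mul_of_nonneg_right (by exact_mod_cast hcard) (by positivity)
        _ = _ := one_mul _
    -- the fourth moments
    have hXY : (X : ℝ) ≤ Y := by rw [hY]; have := abs_nonneg (a : ℝ); linarith
    have hXaY : ((X + a.natAbs : ℕ) : ℝ) ≤ Y := by
      rw [hY]; push_cast; rw [Nat.cast_natAbs, Int.cast_abs]; linarith
    have hmom : ∀ T : ℕ, (T : ℝ) ≤ Y → ∑ j ∈ Icc 1 T, (σ 0 j : ℝ) ^ 4 ≤ C₄ * Y * Real.log Y ^ 32 := by
      intro T hT
      have hT' : Icc 1 T ⊆ Icc 1 ⌊Y⌋₊ := Finset.Icc_subset_Icc_right (Nat.le_floor hT)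
      have hY' : 2 ≤ ⌊Y⌋₊ := Nat.le_floor (by exact_mod_cast hY2)
      have hfl : (⌊Y⌋₊ : ℝ) ≤ Y := Nat.floor_le (by linarith)
      have hfl2 : (2 : ℝ) ≤ ⌊Y⌋₊ := by exact_mod_cast hY'
      calc ∑ j ∈ Icc 1 T, (σ 0 j : ℝ) ^ 4 ≤ ∑ j ∈ Icc 1 ⌊Y⌋₊, (σ 0 j : ℝ) ^ 4 :=
            Finset.sum_le_sum_of_subset_of_nonneg hT' fun j _ _ => by positivity
        _ ≤ C₄ * ⌊Y⌋₊ * Real.log ⌊Y⌋₊ ^ (2 ^ (4 + 1)) := h₄ _ hY'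
        _ ≤ C₄ * Y * Real.log Y ^ 32 := by
            norm_num
            exact mul_le_mul (mul_le_mul_of_nonneg_left hfl hC₄.le)
              (pow_le_pow_left₀ (Real.log_nonneg (by linarith)) (Real.log_le_log (by linarith) hfl) 32)
              (by positivity) (by positivity)
    have h1 : ∑ k ∈ Icc 1 X, (σ 0 k : ℝ) ^ 4 ≤ C₄ * Y * Real.log Y ^ 32 := hmom X hXY
    have h2 : ∑ k ∈ Icc 1 X, (σ 0 ((k : ℤ) - a).natAbs : ℝ) ^ 4 ≤ 2 * (C₄ * Y * Real.log Y ^ 32) :=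
      (sum_sigma_shift_le a X).trans (mul_le_mul_of_nonneg_left (hmom _ hXaY) (by norm_num))
    linarith
  -- assemble
  have hlogQ : (1 + Real.log Q') ^ 2 * (1 + Real.log R') ^ 2 = (1 + Real.log Q') ^ 2 * (1 + Real.log R') ^ 2 := rfl
  calc (∑ r ∈ Icc 1 R', ∑ l ∈ Icc 1 L', ∑ q ∈ Icc 1 Q', roughCongrCount a z M N l (q * r)) +
        ∑ r ∈ Icc 1 R', ∑ l ∈ Icc 1 L', ∑ q ∈ Icc 1 Q', roughCoprimeCount z M N (q * r) / (Nat.totient (q * r) : ℝ)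
      ≤ ((σ 0 a.natAbs : ℝ) ^ 2 * Q' * R' + 3 * C₄ * Y * Real.log Y ^ 32) +
          (X : ℝ) * (1 + Real.log Q') ^ 2 * (1 + Real.log R') ^ 2 :=
        add_le_add ((hA1.trans hA2).trans hA3) hB
    _ = 3 * C₄ * Y * Real.log Y ^ 32 + (σ 0 a.natAbs : ℝ) ^ 2 * Q' * R' +
          (X : ℝ) * (1 + Real.log Q') ^ 2 * (1 + Real.log R') ^ 2 := by ring


end BFI

end Literature.NumberTheory.Sieve
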